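import Summits.BirchSwinnertonDyer.BirchSwinnertonDyer.Theorems.BiquadraticEisensteinDescentHeegnerTwistCouplingInSupplyKrizLiGrossCorner
import Summits.BirchSwinnertonDyer.BirchSwinnertonDyer.Theorems.PrintCFramBottomClassIndexLawFiveLeKrizLi4BlocksC11
import Summits.BirchSwinnertonDyer.BirchSwinnertonDyer.Theorems.PrintCFramBottomClassIndexLawFiveLeKrizLi4Blocks19
import Summits.BirchSwinnertonDyer.BirchSwinnertonDyer.Theorems.PrintCFramBottomClassIndexLawFiveLeKrizLi4BlocksB19
import Summits.BirchSwinnertonDyer.BirchSwinnertonDyer.Theorems.PrintCFramBottomClassIndexLawFiveLeKrizLi4Blocks43and67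
import Summits.BirchSwinnertonDyer.BirchSwinnertonDyer.Theorems.PrintCFramBottomClassIndexLawFiveLeKrizLi4HeegnerHypothesis19and43and67
import HarnessLib

set_option linter.dupNamespace false -- `Summit.BirchSwinnertonDyer.BirchSwinnertonDyer.Theorems.…` (summit = sub, D-0017)
set_option autoImplicit false

/-!
# Crux `HeegnerTwistCouplingInSupply` (stmt-BirchSwinnertonDyer-21381) — the GROSS-CURVE Kriz–Li corners, part II:
# the even-type rows at `q = 11` and the rows at `q = 19, 43, 67` (`ℚ(√−19)`, `ℚ(√−43)`, `ℚ(√−67)`)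

Route `BiquadraticEisensteinDescent` (cell `pub/bsd-wall`, width seat `bsd-wall-cm-bed-w4` g28; `--supports` 21381, helper). Sequel of
`…KrizLiGrossCorner` (part I: the `q`-generic modularity-free Kriz–Li door `twist_L_one_ne_zero_of_thm120_cm`, class membership
`hasCM_cmRamified_of_twist`, the odd-`e` rows at `q = 11`). Here:

* §1 `cruxConclusion_of_block` — the row assembly for ANY Eisenstein prime `q ≥ 5` and ANY CM base `A` with `q` CM-ramified: class
  `W ∼ W₁ ≅ A^{(e)}`, the Kriz–Li block and the Heegner hypothesis over the census field of discriminant `d` (abstracted, as proved BY NAME by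
  cell `bsd-print-cfram`: `exists_krizLiCharacterBlock_<label>`, `satisfiesHeegnerHypothesis_<label>`), `h(d) = h < p` ⟹ the CONCLUSION of
  crux 21381 at `(W, p)`, modulo `hKL`, `hGZ`, `hHP`.
* §2 ★ rows: `94864bt1 = A(11)^{(7)}` (`p = 7`, `K′ = ℚ(√−87)`, `h = 6`), `379456fy1 = A(11)^{(14)}` (`p = 7`, `√−87`),
  `494209i1 = A(19)^{(37)}` (`p = 37`: `37 ≡ 18 (mod 19)` inert; `√−67`, `h = 1`), `61009a1 = A(19)^{(13)}` (`13` inert mod `19`; `√−51`, `h = 2`),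
  `303601f1 = A(19)^{(29)}` (`29 ≡ 10` inert; `√−51`), `46225a1 = A(43)^{(5)}` (`(5/43) = −1`; `√−19`, `h = 1`), `112225a1 = A(67)^{(5)}`
  (`(5/67) = −1`; `√−11`, `h = 1`) — each: **`∃ K′` imaginary quadratic, `4 < |d_{K′}|`, Heegner for `N_W`, `L(W^{(d_{K′})}, 1) ≠ 0`,
  `p ∤ h(K′)`** for every globally minimal member `W` with `r_an(W) ≠ 0`, modulo `hKL`, `hGZ`, `hHP` ONLY. With part I: 14 classes, the
  first corners of crux 21381 on the CM fields `ℚ(√−11)`, `ℚ(√−19)`, `ℚ(√−43)`, `ℚ(√−67)`.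

HONEST FRAMING: corner layer on finitely many isogeny classes (cfram's window); the crux (all CM `W`, all `p`), C⁺, its registered stubs and
BSD are NOT proved. THEOREMS ONLY. Supports stmt-BirchSwinnertonDyer-21381.
[cite: KrizLi2019, Thm. 1.20 (pp. 7–8), Rem. 1.21] [cite: GrossZagier1986, Thm. I.(6.3), V.§1–2] [cite: GrossLMS1991, §1]
[cite: Cox2013, §2.A Thm. 2.13; §7.B Thm. 7.7(ii)]
-/

noncomputable section

open scoped Classical NumberTheorySymbols

namespace Summit.BirchSwinnertonDyer.BirchSwinnertonDyer.Theorems.KrizLiGrossCorner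

open _root_.WeierstrassCurve NumberField
open Literature.NumberTheory.EllipticCurves Literature.NumberTheory.EllipticCurves.KrizLi2019
  Literature.NumberTheory.EllipticCurves.ModularForms Literature.NumberTheory.EllipticCurves.Rank1Residual
  Literature.NumberTheory.QuadraticFields Literature.NumberTheory.QuadraticFields.Quadratic
  Summit.BirchSwinnertonDyer.Rank1Residual Summit.BirchSwinnertonDyer.Rank1Residual.X12.O11.RouteU
  Summit.BirchSwinnertonDyer.BirchSwinnertonDyer.Theorems.PrintCFram
  Summit.BirchSwinnertonDyer.BirchSwinnertonDyer.Theorems.PrintCFram.KrizLiBindersTwisted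

/-! ## §1 Row assembly at any Eisenstein prime `q ≥ 5` and any CM base -/

/-- **Row assembly, `q`-generic.** For a prime `q ≥ 5`, a CM base curve `A` with `q` CM-ramified, a class `W ∼ W₁ ≅ A^{(e)}` (`e ≠ 0`) whose
Kriz–Li block at `q` and Heegner hypothesis over every quadratic `K` of discriminant `d` are given (`hblock`, `hheeg`), a kernel class number
`h(d) = h` (`d < −4`, `d ≡ 1 (mod 4)` squarefree) and a crux prime `p > h`: the CONCLUSION of crux 21381 at `(W, p)`, modulo `hKL`, `hGZ`,
`hHP`. [cite: KrizLi2019, Thm. 1.20 (pp. 7–8)] [cite: Cox2013, §2.A Thm. 2.13; §7.B Thm. 7.7(ii)] -/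
theorem cruxConclusion_of_block {q : ℕ} [Fact q.Prime] (hq5 : 5 ≤ q) (hKL : thm120_padicLogHeegner_unit_of_bernoulli)
    (hGZ : ∀ (N : ℕ) [NeZero N] (W : WeierstrassCurve ℚ) (K : Type) [Field K] [NumberField K], gross_zagier N W K)
    (hHP : ∀ (W : WeierstrassCurve ℚ) (K : Type) [Field K] [NumberField K], exists_isHeegnerPoint W K)
    (A : WeierstrassCurve ℚ) [A.IsElliptic] (hA : A.HasCM) (hAq : CMRamified A q)
    (W W₁ : WeierstrassCurve ℚ) [W.IsElliptic] [W.IsGloballyMinimal] [NeZero (W.conductorNorm ℤ)] [W₁.IsElliptic]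
    (hiso : IsIsogenous W W₁) {e : ℤ} (he : e ≠ 0) (hW₁ : ∃ C : VariableChange ℚ, C • W₁ = A.quadraticTwist ((e : ℤ) : ℚ))
    (hr : W.analyticRank ≠ 0) {d : ℤ} {h p : ℕ} (hd0 : d < 0) (hd4 : d % 4 = 1) (hsf : Squarefree d.natAbs) (hd5 : 4 < d.natAbs)
    (hclass : BinQF.classNumber d = h) (hhp : h < p)
    (hblock : ∀ (K : Type) [Field K] [NumberField K], Module.finrank ℚ K = 2 → NumberField.discr K = d →
      ∀ [NeZero (NumberField.discr K).natAbs],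
      ∃ (f : ℕ) (_ : NeZero f) (ψ : DirichletCharacter ℚ_[q] f) (ω : DirichletCharacter ℚ_[q] q)
        (εK : DirichletCharacter ℚ_[q] (NumberField.discr K).natAbs),
        ψ.IsPrimitive ∧ IsTeichmullerCharacter ω ∧
        (∀ ℓ : ℕ, ℓ.Prime → ¬ (ℓ ∣ q * W.conductorNorm ℤ) →
          ‖((W.LFunction ℓ : ℤ) : ℚ_[q]) - (ψ (ℓ : ZMod f) + ψ⁻¹ (ℓ : ZMod f) * ω (ℓ : ZMod q))‖ < 1) ∧
        (ψ ((q : ℕ) : ZMod f) ≠ 1 ∧ primVal (invMulOmega ψ ω) q ≠ 1) ∧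
        (∀ ℓ : ℕ, (hℓ : ℓ.Prime) → ℓ ≠ q →
          (haveI := Fact.mk hℓ; ¬ W.HasGoodReductionAtPrime ℓ ∧ ¬ W.HasMultiplicativeReductionAtPrime ℓ) →
          ψ (ℓ : ZMod f) ≠ 1 ∧ primVal (invMulOmega ψ ω) ℓ ≠ 1) ∧
        IsKroneckerCharacterOf K εK ∧
        ¬ (‖bernoulliOnePrim (bernoulliCharOne ψ εK) * bernoulliOnePrim (bernoulliCharTwo ψ εK ω)‖ ≤ ((q : ℕ) : ℝ)⁻¹) ∧
        ψ.Odd)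
    (hheeg : ∀ (K : Type) [Field K] [NumberField K], Module.finrank ℚ K = 2 → NumberField.discr K = d →
      SatisfiesHeegnerHypothesis (W.conductorNorm ℤ) K) :
    ∃ (K : Type) (_ : Field K) (_ : NumberField K),
      IsImaginaryQuadratic K ∧ 4 < (NumberField.discr K).natAbs ∧
      SatisfiesHeegnerHypothesis (W.conductorNorm ℤ) K ∧
      (W.quadraticTwist (NumberField.discr K : ℚ)).entireLFunction 1 ≠ 0 ∧ ¬ p ∣ NumberField.classNumber K := by
  obtain ⟨K, iF, iN, hK, hdK, hhK⟩ := SylvesterCorner.exists_field_of_odd d h hd0 hd4 hsf hclass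
  haveI : NeZero (NumberField.discr K).natAbs := ⟨Int.natAbs_ne_zero.mpr (NumberField.discr_ne_zero K)⟩
  obtain ⟨hCM, hram, -⟩ := hasCM_cmRamified_of_twist A hA hAq he W W₁ hiso hW₁
  obtain ⟨f, hf, ψ, ω, εK, hψ, hω, hss, ⟨h1a, h1b⟩, h3, hεK, h4, -⟩ := hblock K hK.1 hdK
  have hHN := hheeg K hK.1 hdK
  obtain ⟨hL, -⟩ := twist_L_one_ne_zero_of_thm120_cm hq5 hKL W hCM hram hr K hK hHN (hGZ _ W K) (hHP W K)
    f ψ ω hψ hω hss h1a h1b h3 εK hεK h4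
  refine ⟨K, iF, iN, hK, by rw [hdK]; exact hd5, hHN, hL, fun hdvd => ?_⟩
  have hh : NumberField.classNumber K < p := by rw [hhK]; exact hhp
  exact absurd (Nat.le_of_dvd (NumberField.classNumber_pos (K := K)) hdvd) (not_le.mpr hh)

/-! ## §2 ★ The rows -/

/-- ★ **`94864bt1 = A(11)^{(7)}`, crux prime `p = 7`** (`7` is inert in `ℚ(√−11)`; even-type twisting discriminant `28`; `K′ = ℚ(√−87)`, `h = 6 < 7`): for every globally minimal `W`
`ℚ`-isogenous to a curve `ℚ`-isomorphic to `cm11.quadraticTwist 7` with `r_an(W) ≠ 0`, the CONCLUSION of crux 21381 at `(W, 7)`,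
modulo `hKL`, `hGZ`, `hHP`. [cite: KrizLi2019, Thm. 1.20 (pp. 7–8)] [cite: Cox2013, §2.A Thm. 2.13] -/
theorem cruxConclusion_94864bt1 (hKL : thm120_padicLogHeegner_unit_of_bernoulli)
    (hGZ : ∀ (N : ℕ) [NeZero N] (W : WeierstrassCurve ℚ) (K : Type) [Field K] [NumberField K], gross_zagier N W K)
    (hHP : ∀ (W : WeierstrassCurve ℚ) (K : Type) [Field K] [NumberField K], exists_isHeegnerPoint W K)
    (W W₁ : WeierstrassCurve ℚ) [W.IsElliptic] [W.IsGloballyMinimal] [NeZero (W.conductorNorm ℤ)] [W₁.IsElliptic]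
    (hiso : IsIsogenous W W₁) (hW₁ : ∃ C : VariableChange ℚ, C • W₁ = cm11.quadraticTwist ((7 : ℤ) : ℚ))
    (hr : W.analyticRank ≠ 0) :
    ∃ (K : Type) (_ : Field K) (_ : NumberField K),
      IsImaginaryQuadratic K ∧ 4 < (NumberField.discr K).natAbs ∧
      SatisfiesHeegnerHypothesis (W.conductorNorm ℤ) K ∧
      (W.quadraticTwist (NumberField.discr K : ℚ)).entireLFunction 1 ≠ 0 ∧ ¬ 7 ∣ NumberField.classNumber K := by
  haveI : Fact (Nat.Prime 11) := ⟨by norm_num⟩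
  exact cruxConclusion_of_block (q := 11) (by norm_num) hKL hGZ hHP cm11 KrizLiBinders.hasCM_bases.2.1 KrizLiBinders.cmRamified_bases.2.1
    W W₁ hiso (by norm_num) hW₁ hr (d := -87) (h := 6) (by norm_num) (by norm_num)
    (by rw [show (-87 : ℤ).natAbs = 3 * 29 from rfl]; exact KrizLi2019.squarefree_mul_of_prime (by norm_num) (by norm_num) (by norm_num))
    (by norm_num) (by decide +kernel) (by norm_num)
    (fun K _ _ hK2 hdK => exists_krizLiCharacterBlock_94864bt1 W W₁ hiso hW₁ K hK2 hdK)
    (fun K _ _ hK2 hdK => satisfiesHeegnerHypothesis_94864bt1 W W₁ hiso hW₁ K hK2 hdK)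

/-- ★ **`379456fy1 = A(11)^{(14)}`, crux prime `p = 7`** (`e = 14 = 2·7`, `7` inert in `ℚ(√−11)`; `K′ = ℚ(√−87)`, `h = 6 < 7`): for every globally minimal `W`
`ℚ`-isogenous to a curve `ℚ`-isomorphic to `cm11.quadraticTwist 14` with `r_an(W) ≠ 0`, the CONCLUSION of crux 21381 at `(W, 7)`,
modulo `hKL`, `hGZ`, `hHP`. [cite: KrizLi2019, Thm. 1.20 (pp. 7–8)] [cite: Cox2013, §2.A Thm. 2.13] -/
theorem cruxConclusion_379456fy1 (hKL : thm120_padicLogHeegner_unit_of_bernoulli)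
    (hGZ : ∀ (N : ℕ) [NeZero N] (W : WeierstrassCurve ℚ) (K : Type) [Field K] [NumberField K], gross_zagier N W K)
    (hHP : ∀ (W : WeierstrassCurve ℚ) (K : Type) [Field K] [NumberField K], exists_isHeegnerPoint W K)
    (W W₁ : WeierstrassCurve ℚ) [W.IsElliptic] [W.IsGloballyMinimal] [NeZero (W.conductorNorm ℤ)] [W₁.IsElliptic]
    (hiso : IsIsogenous W W₁) (hW₁ : ∃ C : VariableChange ℚ, C • W₁ = cm11.quadraticTwist ((14 : ℤ) : ℚ))
    (hr : W.analyticRank ≠ 0) :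
    ∃ (K : Type) (_ : Field K) (_ : NumberField K),
      IsImaginaryQuadratic K ∧ 4 < (NumberField.discr K).natAbs ∧
      SatisfiesHeegnerHypothesis (W.conductorNorm ℤ) K ∧
      (W.quadraticTwist (NumberField.discr K : ℚ)).entireLFunction 1 ≠ 0 ∧ ¬ 7 ∣ NumberField.classNumber K := by
  haveI : Fact (Nat.Prime 11) := ⟨by norm_num⟩
  exact cruxConclusion_of_block (q := 11) (by norm_num) hKL hGZ hHP cm11 KrizLiBinders.hasCM_bases.2.1 KrizLiBinders.cmRamified_bases.2.1
    W W₁ hiso (by norm_num) hW₁ hr (d := -87) (h := 6) (by norm_num) (by norm_num)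
    (by rw [show (-87 : ℤ).natAbs = 3 * 29 from rfl]; exact KrizLi2019.squarefree_mul_of_prime (by norm_num) (by norm_num) (by norm_num))
    (by norm_num) (by decide +kernel) (by norm_num)
    (fun K _ _ hK2 hdK => exists_krizLiCharacterBlock_379456fy1 W W₁ hiso hW₁ K hK2 hdK)
    (fun K _ _ hK2 hdK => satisfiesHeegnerHypothesis_379456fy1 W W₁ hiso hW₁ K hK2 hdK)

/-- ★ **`494209i1 = A(19)^{(37)}`, crux prime `p = 37`** (`37 ≡ 18 (mod 19)` is inert in `ℚ(√−19)`; `K′ = ℚ(√−67)`, `h = 1`): for every globally minimal `W`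
`ℚ`-isogenous to a curve `ℚ`-isomorphic to `cm19.quadraticTwist 37` with `r_an(W) ≠ 0`, the CONCLUSION of crux 21381 at `(W, 37)`,
modulo `hKL`, `hGZ`, `hHP`. [cite: KrizLi2019, Thm. 1.20 (pp. 7–8)] [cite: Cox2013, §2.A Thm. 2.13] -/
theorem cruxConclusion_494209i1 (hKL : thm120_padicLogHeegner_unit_of_bernoulli)
    (hGZ : ∀ (N : ℕ) [NeZero N] (W : WeierstrassCurve ℚ) (K : Type) [Field K] [NumberField K], gross_zagier N W K)
    (hHP : ∀ (W : WeierstrassCurve ℚ) (K : Type) [Field K] [NumberField K], exists_isHeegnerPoint W K)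
    (W W₁ : WeierstrassCurve ℚ) [W.IsElliptic] [W.IsGloballyMinimal] [NeZero (W.conductorNorm ℤ)] [W₁.IsElliptic]
    (hiso : IsIsogenous W W₁) (hW₁ : ∃ C : VariableChange ℚ, C • W₁ = cm19.quadraticTwist ((37 : ℤ) : ℚ))
    (hr : W.analyticRank ≠ 0) :
    ∃ (K : Type) (_ : Field K) (_ : NumberField K),
      IsImaginaryQuadratic K ∧ 4 < (NumberField.discr K).natAbs ∧
      SatisfiesHeegnerHypothesis (W.conductorNorm ℤ) K ∧
      (W.quadraticTwist (NumberField.discr K : ℚ)).entireLFunction 1 ≠ 0 ∧ ¬ 37 ∣ NumberField.classNumber K := by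
  haveI : Fact (Nat.Prime 19) := ⟨by norm_num⟩
  exact cruxConclusion_of_block (q := 19) (by norm_num) hKL hGZ hHP cm19 KrizLiBinders.hasCM_bases.2.2.1 KrizLiBinders.cmRamified_bases.2.2.1
    W W₁ hiso (by norm_num) hW₁ hr (d := -67) (h := 1) (by norm_num) (by norm_num)
    (by rw [show (-67 : ℤ).natAbs = 67 from rfl]; exact (show Nat.Prime 67 by norm_num).squarefree)
    (by norm_num) (by decide +kernel) (by norm_num)
    (fun K _ _ hK2 hdK => exists_krizLiCharacterBlock_494209i1 W W₁ hiso hW₁ K hK2 hdK)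
    (fun K _ _ hK2 hdK => satisfiesHeegnerHypothesis_494209i1 W W₁ hiso hW₁ K hK2 hdK)

/-- ★ **`61009a1 = A(19)^{(13)}`, crux prime `p = 13`** (`13` is a non-residue mod `19`: inert in `ℚ(√−19)`; `K′ = ℚ(√−51)`, `h = 2`): for every globally minimal `W`
`ℚ`-isogenous to a curve `ℚ`-isomorphic to `cm19.quadraticTwist 13` with `r_an(W) ≠ 0`, the CONCLUSION of crux 21381 at `(W, 13)`,
modulo `hKL`, `hGZ`, `hHP`. [cite: KrizLi2019, Thm. 1.20 (pp. 7–8)] [cite: Cox2013, §2.A Thm. 2.13] -/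
theorem cruxConclusion_61009a1 (hKL : thm120_padicLogHeegner_unit_of_bernoulli)
    (hGZ : ∀ (N : ℕ) [NeZero N] (W : WeierstrassCurve ℚ) (K : Type) [Field K] [NumberField K], gross_zagier N W K)
    (hHP : ∀ (W : WeierstrassCurve ℚ) (K : Type) [Field K] [NumberField K], exists_isHeegnerPoint W K)
    (W W₁ : WeierstrassCurve ℚ) [W.IsElliptic] [W.IsGloballyMinimal] [NeZero (W.conductorNorm ℤ)] [W₁.IsElliptic]
    (hiso : IsIsogenous W W₁) (hW₁ : ∃ C : VariableChange ℚ, C • W₁ = cm19.quadraticTwist ((13 : ℤ) : ℚ))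
    (hr : W.analyticRank ≠ 0) :
    ∃ (K : Type) (_ : Field K) (_ : NumberField K),
      IsImaginaryQuadratic K ∧ 4 < (NumberField.discr K).natAbs ∧
      SatisfiesHeegnerHypothesis (W.conductorNorm ℤ) K ∧
      (W.quadraticTwist (NumberField.discr K : ℚ)).entireLFunction 1 ≠ 0 ∧ ¬ 13 ∣ NumberField.classNumber K := by
  haveI : Fact (Nat.Prime 19) := ⟨by norm_num⟩
  exact cruxConclusion_of_block (q := 19) (by norm_num) hKL hGZ hHP cm19 KrizLiBinders.hasCM_bases.2.2.1 KrizLiBinders.cmRamified_bases.2.2.1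
    W W₁ hiso (by norm_num) hW₁ hr (d := -51) (h := 2) (by norm_num) (by norm_num)
    (by rw [show (-51 : ℤ).natAbs = 3 * 17 from rfl]; exact KrizLi2019.squarefree_mul_of_prime (by norm_num) (by norm_num) (by norm_num))
    (by norm_num) (by decide +kernel) (by norm_num)
    (fun K _ _ hK2 hdK => exists_krizLiCharacterBlock_61009a1 W W₁ hiso hW₁ K hK2 hdK)
    (fun K _ _ hK2 hdK => satisfiesHeegnerHypothesis_61009a1 W W₁ hiso hW₁ K hK2 hdK)

/-- ★ **`303601f1 = A(19)^{(29)}`, crux prime `p = 29`** (`29 ≡ 10 (mod 19)` is inert in `ℚ(√−19)`; `K′ = ℚ(√−51)`, `h = 2`): for every globally minimal `W`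
`ℚ`-isogenous to a curve `ℚ`-isomorphic to `cm19.quadraticTwist 29` with `r_an(W) ≠ 0`, the CONCLUSION of crux 21381 at `(W, 29)`,
modulo `hKL`, `hGZ`, `hHP`. [cite: KrizLi2019, Thm. 1.20 (pp. 7–8)] [cite: Cox2013, §2.A Thm. 2.13] -/
theorem cruxConclusion_303601f1 (hKL : thm120_padicLogHeegner_unit_of_bernoulli)
    (hGZ : ∀ (N : ℕ) [NeZero N] (W : WeierstrassCurve ℚ) (K : Type) [Field K] [NumberField K], gross_zagier N W K)
    (hHP : ∀ (W : WeierstrassCurve ℚ) (K : Type) [Field K] [NumberField K], exists_isHeegnerPoint W K)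
    (W W₁ : WeierstrassCurve ℚ) [W.IsElliptic] [W.IsGloballyMinimal] [NeZero (W.conductorNorm ℤ)] [W₁.IsElliptic]
    (hiso : IsIsogenous W W₁) (hW₁ : ∃ C : VariableChange ℚ, C • W₁ = cm19.quadraticTwist ((29 : ℤ) : ℚ))
    (hr : W.analyticRank ≠ 0) :
    ∃ (K : Type) (_ : Field K) (_ : NumberField K),
      IsImaginaryQuadratic K ∧ 4 < (NumberField.discr K).natAbs ∧
      SatisfiesHeegnerHypothesis (W.conductorNorm ℤ) K ∧
      (W.quadraticTwist (NumberField.discr K : ℚ)).entireLFunction 1 ≠ 0 ∧ ¬ 29 ∣ NumberField.classNumber K := by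
  haveI : Fact (Nat.Prime 19) := ⟨by norm_num⟩
  exact cruxConclusion_of_block (q := 19) (by norm_num) hKL hGZ hHP cm19 KrizLiBinders.hasCM_bases.2.2.1 KrizLiBinders.cmRamified_bases.2.2.1
    W W₁ hiso (by norm_num) hW₁ hr (d := -51) (h := 2) (by norm_num) (by norm_num)
    (by rw [show (-51 : ℤ).natAbs = 3 * 17 from rfl]; exact KrizLi2019.squarefree_mul_of_prime (by norm_num) (by norm_num) (by norm_num))
    (by norm_num) (by decide +kernel) (by norm_num)
    (fun K _ _ hK2 hdK => exists_krizLiCharacterBlock_303601f1 W W₁ hiso hW₁ K hK2 hdK)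
    (fun K _ _ hK2 hdK => satisfiesHeegnerHypothesis_303601f1 W W₁ hiso hW₁ K hK2 hdK)

/-- ★ **`46225a1 = A(43)^{(5)}`, crux prime `p = 5`** (`(5/43) = −1`: `5` is inert in `ℚ(√−43)`; `K′ = ℚ(√−19)`, `h = 1`): for every globally minimal `W`
`ℚ`-isogenous to a curve `ℚ`-isomorphic to `cm43.quadraticTwist 5` with `r_an(W) ≠ 0`, the CONCLUSION of crux 21381 at `(W, 5)`,
modulo `hKL`, `hGZ`, `hHP`. [cite: KrizLi2019, Thm. 1.20 (pp. 7–8)] [cite: Cox2013, §2.A Thm. 2.13] -/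
theorem cruxConclusion_46225a1 (hKL : thm120_padicLogHeegner_unit_of_bernoulli)
    (hGZ : ∀ (N : ℕ) [NeZero N] (W : WeierstrassCurve ℚ) (K : Type) [Field K] [NumberField K], gross_zagier N W K)
    (hHP : ∀ (W : WeierstrassCurve ℚ) (K : Type) [Field K] [NumberField K], exists_isHeegnerPoint W K)
    (W W₁ : WeierstrassCurve ℚ) [W.IsElliptic] [W.IsGloballyMinimal] [NeZero (W.conductorNorm ℤ)] [W₁.IsElliptic]
    (hiso : IsIsogenous W W₁) (hW₁ : ∃ C : VariableChange ℚ, C • W₁ = cm43.quadraticTwist ((5 : ℤ) : ℚ))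
    (hr : W.analyticRank ≠ 0) :
    ∃ (K : Type) (_ : Field K) (_ : NumberField K),
      IsImaginaryQuadratic K ∧ 4 < (NumberField.discr K).natAbs ∧
      SatisfiesHeegnerHypothesis (W.conductorNorm ℤ) K ∧
      (W.quadraticTwist (NumberField.discr K : ℚ)).entireLFunction 1 ≠ 0 ∧ ¬ 5 ∣ NumberField.classNumber K := by
  haveI : Fact (Nat.Prime 43) := ⟨by norm_num⟩
  exact cruxConclusion_of_block (q := 43) (by norm_num) hKL hGZ hHP cm43 KrizLiBinders.hasCM_bases.2.2.2.1 KrizLiBinders.cmRamified_bases.2.2.2.1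
    W W₁ hiso (by norm_num) hW₁ hr (d := -19) (h := 1) (by norm_num) (by norm_num)
    (by rw [show (-19 : ℤ).natAbs = 19 from rfl]; exact (show Nat.Prime 19 by norm_num).squarefree)
    (by norm_num) (by decide +kernel) (by norm_num)
    (fun K _ _ hK2 hdK => exists_krizLiCharacterBlock_46225a1 W W₁ hiso hW₁ K hK2 hdK)
    (fun K _ _ hK2 hdK => satisfiesHeegnerHypothesis_46225a1 W W₁ hiso hW₁ K hK2 hdK)

/-- ★ **`112225a1 = A(67)^{(5)}`, crux prime `p = 5`** (`(5/67) = −1`: `5` is inert in `ℚ(√−67)`; `K′ = ℚ(√−11)`, `h = 1`): for every globally minimal `W`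
`ℚ`-isogenous to a curve `ℚ`-isomorphic to `cm67.quadraticTwist 5` with `r_an(W) ≠ 0`, the CONCLUSION of crux 21381 at `(W, 5)`,
modulo `hKL`, `hGZ`, `hHP`. [cite: KrizLi2019, Thm. 1.20 (pp. 7–8)] [cite: Cox2013, §2.A Thm. 2.13] -/
theorem cruxConclusion_112225a1 (hKL : thm120_padicLogHeegner_unit_of_bernoulli)
    (hGZ : ∀ (N : ℕ) [NeZero N] (W : WeierstrassCurve ℚ) (K : Type) [Field K] [NumberField K], gross_zagier N W K)
    (hHP : ∀ (W : WeierstrassCurve ℚ) (K : Type) [Field K] [NumberField K], exists_isHeegnerPoint W K)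
    (W W₁ : WeierstrassCurve ℚ) [W.IsElliptic] [W.IsGloballyMinimal] [NeZero (W.conductorNorm ℤ)] [W₁.IsElliptic]
    (hiso : IsIsogenous W W₁) (hW₁ : ∃ C : VariableChange ℚ, C • W₁ = cm67.quadraticTwist ((5 : ℤ) : ℚ))
    (hr : W.analyticRank ≠ 0) :
    ∃ (K : Type) (_ : Field K) (_ : NumberField K),
      IsImaginaryQuadratic K ∧ 4 < (NumberField.discr K).natAbs ∧
      SatisfiesHeegnerHypothesis (W.conductorNorm ℤ) K ∧
      (W.quadraticTwist (NumberField.discr K : ℚ)).entireLFunction 1 ≠ 0 ∧ ¬ 5 ∣ NumberField.classNumber K := by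
  haveI : Fact (Nat.Prime 67) := ⟨by norm_num⟩
  exact cruxConclusion_of_block (q := 67) (by norm_num) hKL hGZ hHP cm67 KrizLiBinders.hasCM_bases.2.2.2.2.1 KrizLiBinders.cmRamified_bases.2.2.2.2.1
    W W₁ hiso (by norm_num) hW₁ hr (d := -11) (h := 1) (by norm_num) (by norm_num)
    (by rw [show (-11 : ℤ).natAbs = 11 from rfl]; exact (show Nat.Prime 11 by norm_num).squarefree)
    (by norm_num) (by decide +kernel) (by norm_num)
    (fun K _ _ hK2 hdK => exists_krizLiCharacterBlock_112225a1 W W₁ hiso hW₁ K hK2 hdK)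
    (fun K _ _ hK2 hdK => satisfiesHeegnerHypothesis_112225a1 W W₁ hiso hW₁ K hK2 hdK)

end Summit.BirchSwinnertonDyer.BirchSwinnertonDyer.Theorems.KrizLiGrossCorner

end
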